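import Summits.BirchSwinnertonDyer.BirchSwinnertonDyer.Theorems.SmallImageMuTransferMuTransferX9KolyvaginCocycleValue
import HarnessLib

/-!
# Route ByReductionTypeAtTwo, crux `OrdKatoHalfAtTwoIso` (stmt-BirchSwinnertonDyer-19573), line
# `steinberg-fibre-at-two` (skeleton v5): helper W4a (interior step M1 of the registered stub
# `stub_HK_kolyvaginRankOneTwo`) — THE KOLYVAGIN COCYCLE AT THE MEETING POINT WITH ITS VALUE,
# WITHOUT `p ≠ 2` (transversality clause removed)

HONEST FRAMING (cell bsd-2adic): BSD is not proved by any of this; the crux `OrdKatoHalfAtTwoIso` is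
NOT proved here; none of the line's registered stubs is proved here; nothing is booked.  This file is
a KERNEL HELPER for the line `Cruxes/OrdKatoHalfAtTwoIso/Lines/steinberg_fibre_at_two.lean`
(`--supports … --as helper`; it is not one of the line's registered stubs): the `p`-GENERIC Kolyvagin
cocycle with its value, for the Ω road of `stub_port` at `p = 2` (step M1 of `stub_HK_…`).  It is a
VERBATIM port of x10's `KolyvaginTwist.exists_kolyvaginCocycle_value` (file
`…SmallImageMuTransferMuTransferX9KolyvaginCocycleValue`, cell bsd-smallim) with exactly three
changes: (i) the hypothesis `hp2 : p ≠ 2` is dropped; (ii) the one conjunct of the conclusion that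
needs it — transversality `loc_q [Φ] ∈ H¹_tr` (proved there by `C(ℓ−1,2)·𝒯_J = 0`,
`sum_range_natCast_zsmul_eq_zero … hp2 …`, which FAILS at `p = 2` for `ℓ ≡ 3 (mod 4)`: the class
keeps the unramified coordinate `κ̃(Fr) = C(ℓ−1,2)·t_q`) — is dropped; (iii) in its place the
conjunct that holds at EVERY `p`: `Φ` vanishes on `N ∩ ℐ_{𝔓₀}`, `N = Gal(ℚ̄/ℚ(μ_ℓ))`, `𝔓₀` the
distinguished prime of `ℤ̄` over `q` (`derivCocycle_apply_eq_zero`: the `σ`-conjugates of an element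
of `N ∩ ℐ_{𝔓₀}` stay there, where the truncated tame cocycle vanishes — the penultimate clause of
k6-g3's `exists_kolyvaginCocycle_rat`).  At `p = 2` Step 4 pairs `[Φ]` only with an UNRAMIFIED local
class, so only `Φ|_{ℐ_q}` (the value at `τq` and clause (iii)) matters.  THEOREMS ONLY (no
definition, no named fact, no `sorry`); everything stays `p`-generic (any prime `p`, any
`κ : ZpExtension ℚ p`, any `ρ` with `p·M = 0`); the lead instantiates `p = 2`.

## What

**`KolyvaginTwist.exists_kolyvaginCocycle_value_noTransverse`** — data: `κ`, `ρ` over `ℚ` with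
`p·M = 0` and `M^{Gal(ℚ̄/ℚ(μ_ℓ))} = 0`; the Chebotarev place `q` (prime `ℓ`, `ρ` unramified at `q`,
`q ∤ p`, `p ∣ ℓ − 1`); levels `J ≤ L`; a tame cocycle `y'` on `N` with values in `𝒯_L`, unramified at
every prime `𝔓 ∤ p`; a global cocycle `ψ'` of `𝒯_L` with the class-level norm relation
`cor_N [y'] = [ψ']` whose truncation to level `J` vanishes.  Output: a tame generator `σ ∈ ℐ_{𝔓₀}`, a
local inertia element `τq` over it whose mod-`ℓ` cyclotomic character generates `(ℤ/ℓ)ˣ`, `σ` trivial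
on `𝒯_J`, the Kolyvagin cocycle `Φ` of `y = y' mod T^J` with `hx` (unramified at `w ≠ q`, `w ∤ p`,
`ρ` unramified at `w`), **`Φ = 0` on `N ∩ ℐ_{𝔓₀}`**, a local Frobenius `r` with `res r ∈ N`, and the
key relation `Φ(res τq) = −(a' mod T^J)`, `(res r)·a' − a' = −ψ'(res r)` for a level-`L` norm witness
`a'`.  Proof = the odd proof minus its transversality bullet plus the five-line inertia bullet of
`exists_kolyvaginCocycle_rat`.

References: HOME/koly/MU-TRANSFER-PROOF.md §3 (Lemma 2, (3.1)), §5 STEP 3; K. Rubin, *Euler Systems*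
(2000) §4.4 (Def. 4.4.4, Lemma 4.4.2), Thm. 4.5.1 [Rubin2000]; B. Perrin-Riou, Ann. Inst. Fourier 48
(1998) §3.1.2, Prop. 3.1.6 [PerrinRiou1998AIF]; J. Tate, *Number theoretic background* (Corvallis
1979) (1.4.1) [TateCorvallis1979]; tree: `…SmallImageMuTransferMuTransferX9KolyvaginCocycleValue`
(odd twin, proof pattern; credit x10), `…X9KolyvaginClassTwistRat` (clause (iii); credit k6-g3).
-/

-- the summit and its single problem are both named `BirchSwinnertonDyer` (registry layout D-0017)
set_option linter.dupNamespace false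
set_option autoImplicit false

noncomputable section

open CategoryTheory Function Finset
open scoped NumberField Pointwise
open Field IsDedekindDomain NumberField
open Literature.NumberTheory.GaloisRepresentations
open Literature.NumberTheory.GaloisRepresentations.IsNonarchimedeanLocalField
open Literature.NumberTheory.EllipticCurves
open Literature.NumberTheory.EllipticCurves.ZpExtension
open Rat.HeightOneSpectrum
open Summit.BirchSwinnertonDyer.Rank1Residual.GaloisImage
open Summit.BirchSwinnertonDyer.Rank1Residual.GaloisImage.CyclotomicLevel.Rat

namespace Summit.BirchSwinnertonDyer.BirchSwinnertonDyer.Rank1Residual.KolyvaginTwist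

variable {p : ℕ} [Fact p.Prime] {M : Type} [AddCommGroup M] [TopologicalSpace M]
  [DiscreteTopology M] (κ : ZpExtension ℚ p) (ρ : DiscreteGaloisModule ℚ M)
  (hM : ∀ m : M, p • m = 0) (J : ℕ)

/-- **THE KOLYVAGIN COCYCLE AT THE MEETING POINT, WITH ITS VALUE, AT EVERY PRIME `p`**
(MU-TRANSFER-PROOF §3 Lemma 2 + (3.1) + §5 STEP 3, transversality clause removed).  Data: `κ`, `ρ`
over `ℚ` with `p·M = 0` and `M^{Gal(ℚ̄/ℚ(μ_ℓ))} = 0`; the Chebotarev place `q` (prime `ℓ`, `ρ`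
unramified at `q`, `q ∤ p`, `p ∣ ℓ − 1`); levels `J ≤ L`; a tame cocycle `y'` on
`N = Gal(ℚ̄/ℚ(μ_ℓ))` with values in `𝒯_L` that is UNRAMIFIED AT EVERY PRIME `𝔓 ∤ p` (Kato
integrality, level `L`); a global cocycle `ψ'` of `𝒯_L` with the CLASS-LEVEL norm relation
`cor_N [y'] = [ψ']` whose truncation to level `J` vanishes.  Output: a tame generator `σ ∈ ℐ_{𝔓₀}`,
a local inertia element `τq` over it WHOSE mod-`ℓ` CYCLOTOMIC CHARACTER GENERATES, `σ` trivial on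
`𝒯_J`, the Kolyvagin cocycle `Φ` of the truncated class `y = y' mod T^J` with **`hx`** (unramified
at `w ≠ q`, `w ∤ p`, `ρ` unramified at `w`) and **`Φ = 0` on `N ∩ ℐ_{𝔓₀}`** (what survives of
transversality at every `p`), a local Frobenius **`r` with `res r ∈ N`**, and THE KEY RELATION
**`Φ(res τq) = −(a' mod T^J)`, `(res r)·a' − a' = −ψ'(res r)`** for a level-`L` norm witness `a'`.
Verbatim port of x10's `exists_kolyvaginCocycle_value` without `p ≠ 2`.
[cite: Rubin2000, Def. 4.4.4, Lemma 4.4.2 and Thm. 4.5.1] [cite: PerrinRiou1998AIF, §3.1.2 and Prop.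
3.1.6] -/
theorem exists_kolyvaginCocycle_value_noTransverse (q : HeightOneSpectrum (𝓞 ℚ))
    [NeZero ((primesEquiv q : Nat.Primes) : ℕ)] [Fact (((primesEquiv q : Nat.Primes) : ℕ)).Prime]
    [NeZero ((((primesEquiv q : Nat.Primes) : ℕ) : ℕ) : q.adicCompletion ℚ)]
    [hNn : (rootsOfUnityFixer ℚ ((primesEquiv q : Nat.Primes) : ℕ)).Normal]
    [Fintype (absoluteGaloisGroup ℚ ⧸ rootsOfUnityFixer ℚ ((primesEquiv q : Nat.Primes) : ℕ))]
    (hfix : ∀ m : M,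
      (∀ g ∈ rootsOfUnityFixer ℚ ((primesEquiv q : Nat.Primes) : ℕ), ρ g m = m) → m = 0)
    (hpq : (p : 𝓞 ℚ) ∉ q.asIdeal) (hunr : GaloisRep.IsUnramifiedAt q ρ)
    (hdvd : p ∣ ((primesEquiv q : Nat.Primes) : ℕ) - 1)
    {L : ℕ} (hJL : J ≤ L)
    (y' : contOneCocycles (subgroupRep (κ.twistModP ρ hM L).toTopRep
      (rootsOfUnityFixer ℚ ((primesEquiv q : Nat.Primes) : ℕ))))
    (hyI' : ∀ w : HeightOneSpectrum (𝓞 ℚ), (p : 𝓞 ℚ) ∉ w.asIdeal → ∀ 𝔓 ∈ w.primesAbove,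
      resLe (κ.twistModP ρ hM L).toTopRep
        (inf_le_left : rootsOfUnityFixer ℚ ((primesEquiv q : Nat.Primes) : ℕ) ⊓
          𝔓.inertia (absoluteGaloisGroup ℚ) ≤ _) 1 (oneCocycleClass _ y') = 0)
    (ψ' : contOneCocycles (κ.twistModP ρ hM L).toTopRep)
    (hnorm : cores (κ.twistModP ρ hM L).toTopRep
        (rootsOfUnityFixer ℚ ((primesEquiv q : Nat.Primes) : ℕ))
        (isOpen_rootsOfUnityFixer ℚ _) (oneCocycleClass _ y') = oneCocycleClass _ ψ')
    (hψJ : ∀ (g : absoluteGaloisGroup ℚ) (i : Fin J), ψ'.1 g (Fin.castLE hJL i) = 0) :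
    ∃ σ ∈ (adicCompletionPrime ℚ q).inertia (absoluteGaloisGroup ℚ),
      ∃ τq ∈ absInertia (q.adicCompletion ℚ),
      absGaloisRestrict ℚ (q.adicCompletion ℚ) τq = σ ∧
      (∀ u : (ZMod ((primesEquiv q : Nat.Primes) : ℕ))ˣ,
        u ∈ Subgroup.zpowers (modPCyclotomicCharacterZMod (q.adicCompletion ℚ)
          ((primesEquiv q : Nat.Primes) : ℕ) τq)) ∧
      (∀ x : Fin J → M, κ.twistModP ρ hM J σ x = x) ∧
      ∃ Φ : contOneCocycles (κ.twistModP ρ hM J).toTopRep,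
        (∀ w : HeightOneSpectrum (𝓞 ℚ), w ≠ q → (p : 𝓞 ℚ) ∉ w.asIdeal →
          GaloisRep.IsUnramifiedAt w ρ →
          galoisCohomology.localization (κ.twistModP ρ hM J) (Sum.inr w) 1 (oneCocycleClass _ Φ) ∈
            DiscreteGaloisModule.unramifiedSubgroup (GaloisRep.toLocal w (κ.twistModP ρ hM J)) 1) ∧
        (∀ τ ∈ (adicCompletionPrime ℚ q).inertia (absoluteGaloisGroup ℚ),
          τ ∈ rootsOfUnityFixer ℚ ((primesEquiv q : Nat.Primes) : ℕ) → Φ.1 τ = 0) ∧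
        ∃ r : absoluteGaloisGroup (q.adicCompletion ℚ), IsAbsArithFrob r ∧
          absGaloisRestrict ℚ (q.adicCompletion ℚ) r ∈
            rootsOfUnityFixer ℚ ((primesEquiv q : Nat.Primes) : ℕ) ∧
          ∃ a' : Fin L → M,
            (Φ.1 (absGaloisRestrict ℚ (q.adicCompletion ℚ) τq) = fun i => -a' (Fin.castLE hJL i)) ∧
            κ.twistModP ρ hM L (absGaloisRestrict ℚ (q.adicCompletion ℚ) r) a' - a' =
              -ψ'.1 (absGaloisRestrict ℚ (q.adicCompletion ℚ) r) := by
  have h𝔓₀ := adicCompletionPrime_mem_primesAbove ℚ q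
  -- the generator
  obtain ⟨σ, hσI, hσn, hcov, hinj⟩ := exists_generator_mem_inertia q h𝔓₀
  -- inertia of `𝔓₀` acts trivially, at both levels
  have hIL : ∀ τ ∈ (adicCompletionPrime ℚ q).inertia (absoluteGaloisGroup ℚ), ∀ w : Fin L → M,
      (κ.twistModP ρ hM L).toTopRep.ρ τ w = w := fun τ hτ w =>
    twistModP_apply_eq_self_of_mem_inertia κ ρ hM L hpq hunr h𝔓₀ hτ w
  have hIJ : ∀ τ ∈ (adicCompletionPrime ℚ q).inertia (absoluteGaloisGroup ℚ), ∀ w : Fin J → M,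
      (κ.twistModP ρ hM J).toTopRep.ρ τ w = w := fun τ hτ w =>
    twistModP_apply_eq_self_of_mem_inertia κ ρ hM J hpq hunr h𝔓₀ hτ w
  have hσL : ∀ w : Fin L → M, (κ.twistModP ρ hM L).toTopRep.ρ σ w = w := hIL σ hσI
  have hσJ : ∀ w : Fin J → M, (κ.twistModP ρ hM J).toTopRep.ρ σ w = w := hIJ σ hσI
  -- `X_J^N = 0`, `(ℓ - 1) • X = 0` at both levels
  have h0 := twistModP_eq_zero_of_forall_rootsOfUnityFixer κ ρ hM J _ hfix
  have hnXJ : ∀ w : Fin J → M, ((((primesEquiv q : Nat.Primes) : ℕ) - 1 : ℕ) : ℤ) • w = 0 :=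
    fun w => by rw [natCast_zsmul]; exact LocalSplitPrime.sub_one_smul_eq_zero_of_dvd hM hdvd w
  have hnXL : ∀ w : Fin L → M, ((((primesEquiv q : Nat.Primes) : ℕ) - 1 : ℕ) : ℤ) • w = 0 :=
    fun w => by rw [natCast_zsmul]; exact LocalSplitPrime.sub_one_smul_eq_zero_of_dvd hM hdvd w
  -- `y'` vanishes on `N ∩ ℐ_{𝔓₀}`
  have hy'τ := apply_eq_zero_of_resLe_inf_eq_zero _ _
    ((adicCompletionPrime ℚ q).inertia (absoluteGaloisGroup ℚ)) hIL y' (hyI' q hpq _ h𝔓₀)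
  -- the level-`L` norm witness `a'` from the CLASS-LEVEL norm relation
  have h𝒩' : ∑ i ∈ range (((primesEquiv q : Nat.Primes) : ℕ) - 1),
      conjMap (κ.twistModP ρ hM L).toTopRep (rootsOfUnityFixer ℚ ((primesEquiv q : Nat.Primes) : ℕ))
        (σ ^ i) 1 (oneCocycleClass _ y') =
      resSubgroup (κ.twistModP ρ hM L).toTopRep
        (rootsOfUnityFixer ℚ ((primesEquiv q : Nat.Primes) : ℕ)) 1 (oneCocycleClass _ ψ') := by
    rw [sum_conjMap_pow_eq_resSubgroup_cores _ _ (isOpen_rootsOfUnityFixer ℚ _) hcov hinj, hnorm]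
  obtain ⟨a', ha'⟩ := exists_norm_witness_of_sum_conjMap_eq_resSubgroup _ _ σ _ y' ψ' h𝒩'
  -- truncation `π : 𝒯_L → 𝒯_J`, the truncated cocycle `y = π ∘ y'`
  let π : (κ.twistModP ρ hM L).toTopRep ⟶ (κ.twistModP ρ hM J).toTopRep :=
    TopRep.ofHom ⟨(κ.twistModPTruncate ρ hM L hJL).toContinuousLinearMap,
      (κ.twistModPTruncate ρ hM L hJL).isIntertwining'⟩
  have hπ : ∀ x : Fin L → M, π.hom x = fun i => x (Fin.castLE hJL i) := fun _ => rfl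
  let y : contOneCocycles (subgroupRep (κ.twistModP ρ hM J).toTopRep
      (rootsOfUnityFixer ℚ ((primesEquiv q : Nat.Primes) : ℕ))) :=
    contOneCocycles.pullback (ContinuousMonoidHom.id _)
      (Y := subgroupRep (κ.twistModP ρ hM J).toTopRep
        (rootsOfUnityFixer ℚ ((primesEquiv q : Nat.Primes) : ℕ)))
      (TopRep.ofHom ⟨π.hom.toContinuousLinearMap, fun g =>
        π.hom.isIntertwining' (g : absoluteGaloisGroup ℚ)⟩) y'
  have hy : ∀ u, y.1 u = π.hom (y'.1 u) := fun _ => rfl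
  -- the transported norm witness `a = π a'` (the truncation of `ψ'` vanishes): `𝒩y = ∂(π a')`
  have ha : ∀ u : rootsOfUnityFixer ℚ ((primesEquiv q : Nat.Primes) : ℕ),
      ∑ i ∈ range (((primesEquiv q : Nat.Primes) : ℕ) - 1),
        (κ.twistModP ρ hM J).toTopRep.ρ (σ ^ i) (y.1 (subgroupConj _ (σ ^ i) u)) =
      (κ.twistModP ρ hM J).toTopRep.ρ (u : absoluteGaloisGroup ℚ) (π.hom a') - π.hom a' := by
    intro u
    have h := norm_witness_map _ _ π σ _ y' (fun u => ψ'.1 u) a' ha' u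
    have hψ : π.hom (ψ'.1 u) = 0 := by
      rw [hπ]; funext i; exact hψJ _ i
    rw [hψ, zero_add] at h
    exact h
  -- `y` vanishes on `N ∩ ℐ_{𝔓₀}`, in particular at `σ^{ℓ-1}`
  have hyτ : ∀ τ : rootsOfUnityFixer ℚ ((primesEquiv q : Nat.Primes) : ℕ),
      (τ : absoluteGaloisGroup ℚ) ∈ (adicCompletionPrime ℚ q).inertia (absoluteGaloisGroup ℚ) →
        y.1 τ = 0 := fun τ hτ => by
    rw [hy, hy'τ τ hτ, map_zero]
  have hyσn : y.1 ⟨σ ^ (((primesEquiv q : Nat.Primes) : ℕ) - 1), hσn⟩ = 0 :=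
    hyτ ⟨_, hσn⟩ (Subgroup.pow_mem _ hσI _)
  have hgen : ∀ g : absoluteGaloisGroup ℚ, ∃ i : ℕ,
      (σ ^ i)⁻¹ * g ∈ rootsOfUnityFixer ℚ ((primesEquiv q : Nat.Primes) : ℕ) := fun g => by
    obtain ⟨i, -, hi⟩ := hcov g; exact ⟨i, hi⟩
  -- the Kolyvagin cocycle of `y` (Lemma 2), value `Φ(σ) = −π a'`
  obtain ⟨Φ, hΦN, hΦσ, -, -⟩ := exists_kolyvaginCocycle _ _ (isOpen_rootsOfUnityFixer ℚ _)
    h0 hσJ hσn hgen hnXJ y hyσn (π.hom a') ha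
  -- a local inertia element `τq` over `σ`, a local Frobenius `r` restricting into `N`
  have hσ' : σ ∈ (absInertia (q.adicCompletion ℚ)).map
      (absGaloisRestrict ℚ (q.adicCompletion ℚ)).toMonoidHom := by
    rw [← inertia_adicCompletionPrime_eq_map_absInertia]; exact hσI
  obtain ⟨τq, hτq, hτqσ⟩ := Subgroup.mem_map.mp hσ'
  obtain ⟨r, hr, hrN⟩ := exists_isAbsArithFrob_absGaloisRestrict_mem q _ hcov hτq hτqσ
  refine ⟨σ, hσI, τq, hτq, hτqσ,
    forall_mem_zpowers_modPCyclotomicCharacterZMod_of_cov q hcov hτqσ, hσJ, Φ,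
    fun w hwq hwp hwunr => ?_, fun τ hτI hτN => ?_, r, hr, hrN, a', ?_, ?_⟩
  · -- `hx`: unramified at `w ≠ q`, `w ∤ p` (as in p458422, for `y = π ∘ y'`)
    have hwN : ∀ 𝔓 ∈ w.primesAbove, 𝔓.inertia (absoluteGaloisGroup ℚ) ≤
        rootsOfUnityFixer ℚ ((primesEquiv q : Nat.Primes) : ℕ) :=
      rootsOfUnityFixer_unramifiedAt_of_not_mem ℚ _ (natCast_primesEquiv_not_mem_of_ne hwq)
    have hXw : ∀ 𝔓 ∈ w.primesAbove, ∀ τ ∈ 𝔓.inertia (absoluteGaloisGroup ℚ),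
        ∀ x : (κ.twistModP ρ hM L).toTopRep, (κ.twistModP ρ hM L).toTopRep.ρ τ x = x :=
      fun 𝔓 h𝔓 τ hτ x => twistModP_apply_eq_self_of_mem_inertia κ ρ hM L hwp hwunr h𝔓 hτ x
    have hy'w := forall_primesAbove_apply_eq_zero_of_resLe_inf_eq_zero _ _ hwN hXw y' (hyI' w hwp)
    have hyw : ∀ 𝔓 (h𝔓 : 𝔓 ∈ w.primesAbove) (τ : absoluteGaloisGroup ℚ)
        (hτ : τ ∈ 𝔓.inertia (absoluteGaloisGroup ℚ)), y.1 ⟨τ, hwN 𝔓 h𝔓 hτ⟩ = 0 :=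
      fun 𝔓 h𝔓 τ hτ => by rw [hy, hy'w 𝔓 h𝔓 τ hτ, map_zero]
    exact localization_mem_unramifiedSubgroup_of_forall_inertia_apply_eq_zero (κ.twistModP ρ hM J)
      w Φ fun τ hτ => derivCocycle_apply_eq_zero_of_forall_primesAbove _ _ hwN σ _ y hyw Φ hΦN
        (adicCompletionPrime_mem_primesAbove ℚ w) hτ
  · -- vanishing on `N ∩ ℐ_{𝔓₀}` (every `p`): the `σ`-conjugates of `τ` stay in `N ∩ ℐ_{𝔓₀}`
    refine derivCocycle_apply_eq_zero _ _ σ _ y Φ hΦN ⟨τ, hτN⟩ fun i => hyτ _ ?_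
    rw [subgroupConj_apply_coe]
    exact Subgroup.mul_mem _ (Subgroup.mul_mem _ (Subgroup.inv_mem _ (Subgroup.pow_mem _ hσI i))
      hτI) (Subgroup.pow_mem _ hσI i)
  · -- the value at `res τq = σ`: `Φ(σ) = −π a'`
    change Φ.1 ((absGaloisRestrict ℚ (q.adicCompletion ℚ)).toMonoidHom τq) = _
    rw [hτqσ, hΦσ, hπ]
    funext i
    rw [Pi.neg_apply]
  · -- the key relation (3.1) at the Frobenius `φ = res r ∈ N`
    have hkill : ∀ i : ℕ,
        y'.1 ((⟨_, hrN⟩ : rootsOfUnityFixer ℚ ((primesEquiv q : Nat.Primes) : ℕ))⁻¹ *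
          subgroupConj _ (σ ^ i) ⟨_, hrN⟩) = 0 := fun i =>
      hy'τ _ (inv_mul_conj_mem_of_normalises
        ((adicCompletionPrime ℚ q).inertia (absoluteGaloisGroup ℚ))
        (fun τ hτ => absGaloisRestrict_normalises_inertia_adicCompletionPrime q r hτ) hσI i)
    have h := rho_sub_eq_of_norm_witness _ _ hσL _ y' (fun u => ψ'.1 u) a' ha' ⟨_, hrN⟩ hkill
    have hn0 : (((primesEquiv q : Nat.Primes) : ℕ) - 1) •
        y'.1 ⟨absGaloisRestrict ℚ (q.adicCompletion ℚ) r, hrN⟩ = 0 := by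
      have := hnXL (y'.1 ⟨absGaloisRestrict ℚ (q.adicCompletion ℚ) r, hrN⟩)
      rwa [natCast_zsmul] at this
    rw [hn0, zero_sub, toTopRep_twistModP_ρ_apply] at h
    exact h

end Summit.BirchSwinnertonDyer.BirchSwinnertonDyer.Rank1Residual.KolyvaginTwist

end
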